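import Mathlib.Analysis.SpecialFunctions.Exp
import Mathlib.Algebra.Order.BigOperators.Ring.Finset
import Mathlib.Analysis.InnerProductSpace.Basic
import Mathlib.Analysis.Normed.Operator.NormedSpace
import Mathlib.Algebra.BigOperators.Fin
import HarnessLib

/-!
# Slow/fast block recursions: composing slot maps with a weighted (slaving) norm

Topic `Literature/Analysis/ODE` (namespace `Literature.Analysis.ODE.BlockRecursion`). Everything here is PROVED (no
definition, no named fact). A sequence of SLOT MAPS in Kokotović's block-triangular two-time-scale form
[cite: KokotovicBensoussanBlankenship1987, Kokotović §2 (2.16)–(2.20), Thm 2.3] — slow amplitude `A k ≥ 0`, fast size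
`F k ≥ 0`, and per slot `k` four nonnegative constants `(m, φ, ψ, χ)` with

  `|A (k+1) − m_k A k| ≤ φ_k F k`,   `F (k+1) ≤ ψ_k m_k A k + χ_k F k`

(the shape produced for three-term ladders by `Literature.Analysis.ODE.IntWindowLadder.exists_slotMap_intWindow`) — is
composed across slots by ONE weighted norm `A ± β F` (a discrete slaving / Lyapunov weight, the error-transport
bookkeeping of [cite: HairerNorsettWanner1993, §II.3 (3.25), Thms 3.4–3.6]): the weight `β` is paid ONCE, in the
prefactor, and each slot then costs only the factor `m_k (1 ± β ψ_k)` — i.e. a per-switch overhead `1 + O(φψ)` on top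
of the product of the multipliers, uniformly in the number of slots and in their lengths.

* `weighted_le_prod` — if `φ_k + β χ_k ≤ β m_k` for all `k` (the fast part relaxes faster than it is fed), then
  `A n + β F n ≤ (Π_{k<n} m_k (1 + β ψ_k)) (A 0 + β F 0)`;
* `slow_le_exp_mul_prod` — hence `A n ≤ exp (β Σ_{k<n} ψ_k) (Π_{k<n} m_k) (A 0 + β F 0)`;
* `weighted_ge_prod` — the matching LOWER law: if `φ_k + γ χ_k ≤ γ m_k (1 − γ ψ_k)` and `γ ψ_k ≤ 1`, then
  `(Π_{k<n} m_k (1 − γ ψ_k)) (A 0 − γ F 0) ≤ A n − γ F n`, in particular `A n ≥ (Π m_k (1 − γψ_k)) (A 0 − γ F 0)`.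

The point of the weighted form is that it is MULTIPLICATIVE: the error rides on the (decaying) product of the
multipliers, so it composes over infinitely many steps and yields a decay RATE; the additive companion
`Literature.Analysis.ODE.PerturbedRecursion` (errors relative to the initial size) is the tool for a FINITE stretch.

Use (cell `ad-ideate`, K2R `stub_lowSectorDecay` §4 / `stub_upperSome`): `k` indexes PERIODS of the shear word (over
one period the slow map of the low sector is isotropic to leading order, so the slow state is measured by one norm
`A k`); `m_k` = norm of the period's slow map (product of the slot multipliers of `slotMap_law_intWindow` /
`column_law_trapezoid(Pair)`, composed within the period by `NearCommutingProduct` / `PerturbedRecursion`), `φ_k`, `ψ_k`,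
`χ_k` = the period's feed / slaved residual / fast relaxation assembled from the slot constants
`(g_Tγ/Δ)e^{x'τ}`, `Λ(|s_0||j₁| + |s_{−1}||j₋₁|) + Q`, `e^{−ΛΔτ} + (g_Tγ/Δ)²e^{x'τ}` of `slotMap_slow/fast_intWindow` —
so `β ≈ φ/(m − χ) = O(g_T)` and the per-period overhead is `1 + βψ = 1 + O(g_T²)`, uniform in the number of periods
and in the slot lengths, against the gain `e^{−c M g_T²}`-type inside `m_k`.
-/

namespace Literature.Analysis.ODE

namespace BlockRecursion

open Finset Real

/-! ## §1 The upper law with the slaving weight `β` -/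

/-- **Weighted upper law for a slow/fast block recursion.** With `F ≥ 0`, `m, ψ ≥ 0`, `β ≥ 0`, the block
estimates `A (k+1) ≤ m_k A k + φ_k F k`, `F (k+1) ≤ ψ_k m_k A k + χ_k F k` and the relaxation condition
`φ_k + β χ_k ≤ β m_k`: `A n + β F n ≤ (Π_{k<n} m_k (1 + β ψ_k)) (A 0 + β F 0)`.
[cite: KokotovicBensoussanBlankenship1987, Kokotović §2 (2.16)–(2.20), Thm 2.3]
[cite: HairerNorsettWanner1993, §II.3 (3.25)] -/
theorem weighted_le_prod (A F m φ ψ χ : ℕ → ℝ) (β : ℝ)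
    (hF0 : ∀ k, 0 ≤ F k) (hm : ∀ k, 0 ≤ m k) (hψ : ∀ k, 0 ≤ ψ k) (hβ : 0 ≤ β)
    (hfeed : ∀ k, φ k + β * χ k ≤ β * m k)
    (hA : ∀ k, A (k + 1) ≤ m k * A k + φ k * F k)
    (hF : ∀ k, F (k + 1) ≤ ψ k * m k * A k + χ k * F k) :
    ∀ n, A n + β * F n ≤ (∏ k ∈ range n, m k * (1 + β * ψ k)) * (A 0 + β * F 0) := by
  intro n
  induction n with
  | zero => simp
  | succ n ih =>
    have hfac : 0 ≤ m n * (1 + β * ψ n) := mul_nonneg (hm n) (by nlinarith [hψ n, hβ])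
    -- one step of the weighted norm
    have step : A (n + 1) + β * F (n + 1) ≤ m n * (1 + β * ψ n) * (A n + β * F n) := by
      have h1 := hA n
      have h2 := hF n
      have h3 : β * F (n + 1) ≤ β * (ψ n * m n * A n + χ n * F n) := mul_le_mul_of_nonneg_left h2 hβ
      have h4 : (φ n + β * χ n) * F n ≤ β * m n * F n := mul_le_mul_of_nonneg_right (hfeed n) (hF0 n)
      have h5 : 0 ≤ β * ψ n * (β * F n) * m n := by
        have := hψ n; have := hF0 n; have := hm n; positivity
      nlinarith
    calc A (n + 1) + β * F (n + 1) ≤ m n * (1 + β * ψ n) * (A n + β * F n) := step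
      _ ≤ m n * (1 + β * ψ n) * ((∏ k ∈ range n, m k * (1 + β * ψ k)) * (A 0 + β * F 0)) :=
          mul_le_mul_of_nonneg_left ih hfac
      _ = (∏ k ∈ range (n + 1), m k * (1 + β * ψ k)) * (A 0 + β * F 0) := by
          rw [Finset.prod_range_succ]; ring

/-- **Slow amplitude after `n` slots**: `A n ≤ exp (β Σ_{k<n} ψ_k) · (Π_{k<n} m_k) · (A 0 + β F 0)` — the per-slot
overhead `1 + βψ_k ≤ e^{βψ_k}` on top of the product of the multipliers, the weight `β` paid once in the prefactor.
[cite: HairerNorsettWanner1993, §II.3 Thm 3.6 (3.29)] -/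
theorem slow_le_exp_mul_prod (A F m φ ψ χ : ℕ → ℝ) (β : ℝ)
    (hA0 : 0 ≤ A 0) (hF0 : ∀ k, 0 ≤ F k) (hm : ∀ k, 0 ≤ m k) (hψ : ∀ k, 0 ≤ ψ k) (hβ : 0 ≤ β)
    (hfeed : ∀ k, φ k + β * χ k ≤ β * m k)
    (hA : ∀ k, A (k + 1) ≤ m k * A k + φ k * F k)
    (hF : ∀ k, F (k + 1) ≤ ψ k * m k * A k + χ k * F k) (n : ℕ) :
    A n ≤ Real.exp (β * ∑ k ∈ range n, ψ k) * (∏ k ∈ range n, m k) * (A 0 + β * F 0) := by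
  have hw := weighted_le_prod A F m φ ψ χ β hF0 hm hψ hβ hfeed hA hF n
  have hN0 : 0 ≤ A 0 + β * F 0 := by have := hF0 0; positivity
  have hprod : ∏ k ∈ range n, m k * (1 + β * ψ k) ≤ Real.exp (β * ∑ k ∈ range n, ψ k) * ∏ k ∈ range n, m k := by
    rw [Finset.prod_mul_distrib, mul_comm, Finset.mul_sum, Real.exp_sum]
    refine mul_le_mul_of_nonneg_right ?_ (Finset.prod_nonneg fun k _ => hm k)
    refine Finset.prod_le_prod (fun k _ => by nlinarith [hψ k, hβ]) fun k _ => ?_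
    have := Real.add_one_le_exp (β * ψ k)
    linarith
  calc A n ≤ A n + β * F n := le_add_of_nonneg_right (mul_nonneg hβ (hF0 n))
    _ ≤ (∏ k ∈ range n, m k * (1 + β * ψ k)) * (A 0 + β * F 0) := hw
    _ ≤ Real.exp (β * ∑ k ∈ range n, ψ k) * (∏ k ∈ range n, m k) * (A 0 + β * F 0) :=
        mul_le_mul_of_nonneg_right hprod hN0

/-! ## §2 The lower law with the weight `γ` -/

/-- **Weighted lower law for a slow/fast block recursion.** With `F ≥ 0`, `m ≥ 0`, the two-sided slow estimate in
the form `m_k A k − φ_k F k ≤ A (k+1)`, the fast estimate `F (k+1) ≤ ψ_k m_k A k + χ_k F k`, and a weight `γ ≥ 0` with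
`γ ψ_k ≤ 1` and `φ_k + γ χ_k ≤ γ m_k (1 − γ ψ_k)`:
`(Π_{k<n} m_k (1 − γ ψ_k)) (A 0 − γ F 0) ≤ A n − γ F n` — a LOWER bound on the slow amplitude by the product of the
multipliers, up to the per-slot factors `1 − γψ_k` and the initial fast content.
[cite: KokotovicBensoussanBlankenship1987, Kokotović §2 (2.16)–(2.20), Thm 2.3]
[cite: HairerNorsettWanner1993, §II.3 (3.25)] -/
theorem weighted_ge_prod (A F m φ ψ χ : ℕ → ℝ) (γ : ℝ)
    (hF0 : ∀ k, 0 ≤ F k) (hm : ∀ k, 0 ≤ m k) (hγ : 0 ≤ γ) (hγψ : ∀ k, γ * ψ k ≤ 1)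
    (hfeed : ∀ k, φ k + γ * χ k ≤ γ * m k * (1 - γ * ψ k))
    (hA : ∀ k, m k * A k - φ k * F k ≤ A (k + 1))
    (hF : ∀ k, F (k + 1) ≤ ψ k * m k * A k + χ k * F k) :
    ∀ n, (∏ k ∈ range n, m k * (1 - γ * ψ k)) * (A 0 - γ * F 0) ≤ A n - γ * F n := by
  intro n
  induction n with
  | zero => simp
  | succ n ih =>
    have hfac : 0 ≤ m n * (1 - γ * ψ n) := mul_nonneg (hm n) (by linarith [hγψ n])
    have step : m n * (1 - γ * ψ n) * (A n - γ * F n) ≤ A (n + 1) - γ * F (n + 1) := by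
      have h1 := hA n
      have h2 := hF n
      have h3 : γ * F (n + 1) ≤ γ * (ψ n * m n * A n + χ n * F n) := mul_le_mul_of_nonneg_left h2 hγ
      have h4 : (φ n + γ * χ n) * F n ≤ γ * m n * (1 - γ * ψ n) * F n :=
        mul_le_mul_of_nonneg_right (hfeed n) (hF0 n)
      nlinarith
    calc (∏ k ∈ range (n + 1), m k * (1 - γ * ψ k)) * (A 0 - γ * F 0)
        = m n * (1 - γ * ψ n) * ((∏ k ∈ range n, m k * (1 - γ * ψ k)) * (A 0 - γ * F 0)) := by
          rw [Finset.prod_range_succ]; ring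
      _ ≤ m n * (1 - γ * ψ n) * (A n - γ * F n) := mul_le_mul_of_nonneg_left ih hfac
      _ ≤ A (n + 1) - γ * F (n + 1) := step

/-- **Lower bound on the slow amplitude**: under the hypotheses of `weighted_ge_prod`,
`A n ≥ (Π_{k<n} m_k (1 − γ ψ_k)) (A 0 − γ F 0)` (drop the fast content `γ F n ≥ 0`).
[cite: KokotovicBensoussanBlankenship1987, Kokotović §2 Thm 2.3] -/
theorem slow_ge_prod (A F m φ ψ χ : ℕ → ℝ) (γ : ℝ)
    (hF0 : ∀ k, 0 ≤ F k) (hm : ∀ k, 0 ≤ m k) (hγ : 0 ≤ γ) (hγψ : ∀ k, γ * ψ k ≤ 1)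
    (hfeed : ∀ k, φ k + γ * χ k ≤ γ * m k * (1 - γ * ψ k))
    (hA : ∀ k, m k * A k - φ k * F k ≤ A (k + 1))
    (hF : ∀ k, F (k + 1) ≤ ψ k * m k * A k + χ k * F k) (n : ℕ) :
    (∏ k ∈ range n, m k * (1 - γ * ψ k)) * (A 0 - γ * F 0) ≤ A n := by
  have h := weighted_ge_prod A F m φ ψ χ γ hF0 hm hγ hγψ hfeed hA hF n
  have : 0 ≤ γ * F n := mul_nonneg hγ (hF0 n)
  linarith

/-! ## One period from its slots (amendment 1): vector slow state, scalar fast size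

The slot maps of one PERIOD act on a slow state `α j` in a normed space `E` (the principal amplitude vector on the
polarisation plane of the low sector) by near-isometric contractions `D j`, up to a feed from the fast content, while
the fast size obeys the scalar slaving recursion; composing the `J` slots of the period gives the period-level block
`(m, φ, ψ, χ)` consumed by `slow_ge_prod` / `weighted_ge_prod` above, with `m` the LOWER multiplier of the ordered
product `D (J-1) ∘ ⋯ ∘ D 0` — supplied, for products of near-identity factors `1 − B_j`, by the second-order
expansion `norm_prod_one_sub_apply_ge`.  Error transport through compositions of one-step maps is again
[cite: HairerNorsettWanner1993, §II.3 (3.25), Thms 3.4–3.6]; the second-order expansion of a product of near-identity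
factors is the operator form of the rounding-error lemma `Π (1 + δ_i) = 1 + θ_n` [cite: Higham2002, Lemma 3.1].
Signatures as fixed by the `stub_upperSome` plan of cell `ad-ideate` (r19, helpers F-U1 / F-U3). -/

section PeriodBlock

open scoped InnerProductSpace

/-- Triangle inequality for list sums. [cite: Higham2002, Lemma 3.1] -/
private theorem norm_listSum_le' {A : Type*} [SeminormedAddCommGroup A] (l : List A) :
    ‖l.sum‖ ≤ (l.map fun B => ‖B‖).sum := by
  induction l with
  | nil => simp
  | cons B l ih =>
    rw [List.sum_cons, List.map_cons, List.sum_cons]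
    exact (norm_add_le _ _).trans (add_le_add le_rfl ih)

/-- Second-order expansion of a product of near-identity factors in a normed ring: if `Σ_j ‖B_j‖ ≤ 1` then
`‖Π_j (1 − B_j) − (1 − Σ_j B_j)‖ ≤ (Σ_j ‖B_j‖)²` (private copy of the Summits-side helper
`…NearCommutingProduct.norm_listProd_one_sub_sub_le`, which Literature cannot import).
[cite: Higham2002, Lemma 3.1] -/
private theorem norm_listProd_one_sub_sub_le' {A : Type*} [NormedRing A] (l : List A)
    (hl : (l.map fun B => ‖B‖).sum ≤ 1) :
    ‖(l.map fun B => 1 - B).prod - (1 - l.sum)‖ ≤ (l.map fun B => ‖B‖).sum ^ 2 := by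
  induction l with
  | nil => simp
  | cons B l ih =>
    rw [List.map_cons, List.sum_cons] at hl
    have hN0 : 0 ≤ (l.map fun B => ‖B‖).sum :=
      List.sum_nonneg (by
        intro x hx
        obtain ⟨y, -, rfl⟩ := List.mem_map.1 hx
        exact norm_nonneg y)
    have hb0 : 0 ≤ ‖B‖ := norm_nonneg B
    have hN1 : (l.map fun B => ‖B‖).sum ≤ 1 := by linarith
    have ih' := ih hN1
    set P := (l.map fun B => 1 - B).prod with hP
    set N := (l.map fun B => ‖B‖).sum with hN
    set R := P - (1 - l.sum) with hR
    rw [List.map_cons, List.prod_cons, List.map_cons, List.sum_cons, List.sum_cons, ← hP]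
    have hPe : P = (1 - l.sum) + R := by rw [hR]; abel
    have key : (1 - B) * P - (1 - (B + l.sum)) = R + B * l.sum - B * R := by
      rw [hPe]; noncomm_ring
    rw [key]
    have h1 : ‖R + B * l.sum - B * R‖ ≤ ‖R‖ + ‖B‖ * ‖l.sum‖ + ‖B‖ * ‖R‖ := by
      refine (norm_sub_le _ _).trans (add_le_add ((norm_add_le _ _).trans (add_le_add le_rfl ?_)) ?_)
      · exact norm_mul_le _ _
      · exact norm_mul_le _ _
    have h2 : ‖l.sum‖ ≤ N := norm_listSum_le' l
    have h3 : ‖R‖ ≤ N ^ 2 := ih'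
    have h4 : ‖B‖ * ‖l.sum‖ ≤ ‖B‖ * N := mul_le_mul_of_nonneg_left h2 hb0
    have h5 : ‖B‖ * ‖R‖ ≤ ‖B‖ * N ^ 2 := mul_le_mul_of_nonneg_left h3 hb0
    have h6 : ‖B‖ * N ^ 2 ≤ ‖B‖ * N := by
      refine mul_le_mul_of_nonneg_left ?_ hb0
      nlinarith
    nlinarith

variable {E : Type*} [NormedAddCommGroup E] [InnerProductSpace ℝ E]

/-- **F-U1 (period slow map, lower side).** If `Σ_j ‖B_j‖ ≤ X ≤ 1` and the quadratic form of the sum is bounded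
ABOVE, `⟪(Σ_j B_j) x, x⟫ ≤ M ‖x‖²`, then the ORDERED product applied to any vector satisfies
`(1 − M − X²) ‖x‖ ≤ ‖(Π_j (1 − B_j)) x‖`: second-order expansion (remainder `X²`) plus
`‖(1 − ΣB)x‖ ‖x‖ ≥ ⟪(1 − ΣB)x, x⟫ ≥ (1 − M)‖x‖²` — no symmetry or sign condition on the `B_j`.
[cite: Higham2002, Lemma 3.1] [cite: HairerNorsettWanner1993, §II.3 (3.25)] -/
theorem norm_prod_one_sub_apply_ge {n : ℕ} (B : Fin n → (E →L[ℝ] E)) (X M : ℝ)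
    (hX : ∑ j, ‖B j‖ ≤ X) (hX1 : X ≤ 1)
    (hM : ∀ x : E, ⟪(∑ j, B j) x, x⟫_ℝ ≤ M * ‖x‖ ^ 2) (x : E) :
    (1 - M - X ^ 2) * ‖x‖ ≤ ‖(List.ofFn fun j => (1 : E →L[ℝ] E) - B j).prod x‖ := by
  set l : List (E →L[ℝ] E) := List.ofFn B with hl
  have hmap : (List.ofFn fun j => (1 : E →L[ℝ] E) - B j) = l.map fun B => 1 - B := by
    rw [hl, List.map_ofFn]; rfl
  have hsum : l.sum = ∑ j, B j := by rw [hl, List.sum_ofFn]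
  have hnorm : (l.map fun B => ‖B‖).sum = ∑ j, ‖B j‖ := by
    rw [hl, List.map_ofFn, List.sum_ofFn]; rfl
  have hN0 : 0 ≤ ∑ j, ‖B j‖ := Finset.sum_nonneg fun j _ => norm_nonneg _
  have hN1 : (l.map fun B => ‖B‖).sum ≤ 1 := by rw [hnorm]; linarith
  have hrem := norm_listProd_one_sub_sub_le' l hN1
  rw [hnorm, hsum] at hrem
  have hsq : (∑ j, ‖B j‖) ^ 2 ≤ X ^ 2 := pow_le_pow_left₀ hN0 hX 2
  set P : E →L[ℝ] E := (l.map fun B => 1 - B).prod with hP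
  set S : E →L[ℝ] E := ∑ j, B j with hS
  -- the main term: ‖(1 − S) x‖ ≥ (1 − M) ‖x‖
  have hmain : (1 - M) * ‖x‖ ≤ ‖((1 : E →L[ℝ] E) - S) x‖ := by
    have hinner : (1 - M) * ‖x‖ ^ 2 ≤ ⟪((1 : E →L[ℝ] E) - S) x, x⟫_ℝ := by
      rw [sub_apply, one_apply_eq_self, inner_sub_left, real_inner_self_eq_norm_sq]
      have := hM x
      linarith
    have hcs : ⟪((1 : E →L[ℝ] E) - S) x, x⟫_ℝ ≤ ‖((1 : E →L[ℝ] E) - S) x‖ * ‖x‖ :=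
      real_inner_le_norm _ _
    by_cases hx : x = 0
    · simp [hx]
    · have hxpos : 0 < ‖x‖ := norm_pos_iff.2 hx
      have h := hinner.trans hcs
      rw [pow_two, ← mul_assoc] at h
      exact le_of_mul_le_mul_right h hxpos
  -- the remainder applied to x
  have hremx : ‖(P - (1 - S)) x‖ ≤ X ^ 2 * ‖x‖ :=
    (ContinuousLinearMap.le_opNorm _ _).trans (mul_le_mul_of_nonneg_right (hrem.trans hsq) (norm_nonneg _))
  rw [hmap]
  have hdecomp : ((1 : E →L[ℝ] E) - S) x = P x - (P - (1 - S)) x := by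
    simp only [sub_apply]; abel
  have htri : ‖((1 : E →L[ℝ] E) - S) x‖ ≤ ‖P x‖ + ‖(P - (1 - S)) x‖ := by
    rw [hdecomp]; exact norm_sub_le _ _
  have : (1 - M - X ^ 2) * ‖x‖ = (1 - M) * ‖x‖ - X ^ 2 * ‖x‖ := by ring
  rw [this]
  linarith

omit [InnerProductSpace ℝ E] in
/-- Reversed ordered products: `D J ∘ (D (J-1) ∘ ⋯ ∘ D 0) = D J ∘ ⋯ ∘ D 0` as `List.ofFn` products (bookkeeping).
[cite: HairerNorsettWanner1993, §II.3 (3.25)] -/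
private theorem prod_ofFn_rev_succ [NormedSpace ℝ E] (D : ℕ → (E →L[ℝ] E)) (J : ℕ) :
    (List.ofFn fun j : Fin (J + 1) => D (J + 1 - 1 - (j : ℕ))).prod =
      D J * (List.ofFn fun j : Fin J => D (J - 1 - (j : ℕ))).prod := by
  rw [List.ofFn_succ, List.prod_cons]
  have h0 : D (J + 1 - 1 - ((0 : Fin (J + 1)) : ℕ)) = D J := by simp
  have h1 : (fun i : Fin J => D (J + 1 - 1 - (i.succ : ℕ))) = fun j : Fin J => D (J - 1 - (j : ℕ)) := by
    funext j
    simp only [Fin.val_succ, Nat.add_sub_cancel]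
    congr 1
    omega
  rw [h0, h1]

omit [InnerProductSpace ℝ E] in
/-- **F-U3 (one period from its slots: the block form for `slow_ge_prod`).** Slot maps `j < J` inside one period:
the slow state `α j : E` is propagated by contractions `D j` (`‖D j‖ ≤ 1`) up to a feed from the fast content,
`‖α (j+1) − D j (α j)‖ ≤ φ j · F j`, and the fast size obeys `F (j+1) ≤ ψ j ‖α j‖ + χ j F j` with `0 ≤ χ j ≤ 1`.
If the ordered product of the `D j` loses at most the factor `m` (`m ‖v‖ ≤ ‖(D (J-1) ∘ ⋯ ∘ D 0) v‖`, e.g. from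
`norm_prod_one_sub_apply_ge`) and `Φ Ψ ≤ 1/2` (`Φ = Σ_{j<J} φ j`, `Ψ = Σ_{j<J} ψ j`), then the period has the block
form `(m − 2ΦΨ) ‖α 0‖ − 2Φ F 0 ≤ ‖α J‖` and `F J ≤ 2Ψ ‖α 0‖ + (2ΦΨ + Π_{j<J} χ j) F 0`.
Proof: with `S = max_{j ≤ J} ‖α j‖`, by induction `F j ≤ (Σ_{i<j} ψ i) S + (Π_{i<j} χ i) F 0` and
`‖α j‖ ≤ ‖α 0‖ + (Σ_{i<j} φ i)(Ψ S + F 0)`, whence `S ≤ 2(‖α 0‖ + Φ F 0)`; the deviation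
`v j = α j − (D (j-1) ∘ ⋯ ∘ D 0) α 0` obeys `‖v (j+1)‖ ≤ ‖v j‖ + φ j F j`.
[cite: HairerNorsettWanner1993, §II.3 (3.25), Thms 3.4–3.6]
[cite: KokotovicBensoussanBlankenship1987, Kokotović §2 (2.16)–(2.20), Thm 2.3] -/
theorem period_block_of_slot_blocks [NormedSpace ℝ E] (J : ℕ) (α : ℕ → E) (D : ℕ → (E →L[ℝ] E))
    (F φ ψ χ : ℕ → ℝ) (m : ℝ)
    (hD : ∀ j < J, ‖D j‖ ≤ 1) (hF0 : ∀ j ≤ J, 0 ≤ F j) (hφ : ∀ j < J, 0 ≤ φ j) (hψ : ∀ j < J, 0 ≤ ψ j)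
    (hχ : ∀ j < J, 0 ≤ χ j ∧ χ j ≤ 1)
    (hslow : ∀ j < J, ‖α (j + 1) - D j (α j)‖ ≤ φ j * F j)
    (hfast : ∀ j < J, F (j + 1) ≤ ψ j * ‖α j‖ + χ j * F j)
    (hm : ∀ v : E, m * ‖v‖ ≤ ‖(List.ofFn fun j : Fin J => D (J - 1 - (j : ℕ))).prod v‖)
    (hΦΨ : (∑ j ∈ range J, φ j) * (∑ j ∈ range J, ψ j) ≤ 1 / 2) :
    (m - 2 * (∑ j ∈ range J, φ j) * (∑ j ∈ range J, ψ j)) * ‖α 0‖ - 2 * (∑ j ∈ range J, φ j) * F 0 ≤ ‖α J‖ ∧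
      F J ≤ 2 * (∑ j ∈ range J, ψ j) * ‖α 0‖ +
        (2 * (∑ j ∈ range J, φ j) * (∑ j ∈ range J, ψ j) + ∏ j ∈ range J, χ j) * F 0 := by
  set Φ : ℝ := ∑ j ∈ range J, φ j with hΦdef
  set Ψ : ℝ := ∑ j ∈ range J, ψ j with hΨdef
  -- the running maximum of the slow norms over the period
  set S : ℝ := (range (J + 1)).sup' ⟨0, by simp⟩ (fun j => ‖α j‖) with hSdef
  have hS_ge : ∀ j ≤ J, ‖α j‖ ≤ S := fun j hj =>
    Finset.le_sup' (fun j => ‖α j‖) (Finset.mem_range.2 (Nat.lt_succ_of_le hj))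
  have hS0 : 0 ≤ S := (norm_nonneg (α 0)).trans (hS_ge 0 (Nat.zero_le J))
  have hF00 : 0 ≤ F 0 := hF0 0 (Nat.zero_le J)
  have hΦ0 : 0 ≤ Φ := Finset.sum_nonneg fun j hj => hφ j (Finset.mem_range.1 hj)
  have hΨ0 : 0 ≤ Ψ := Finset.sum_nonneg fun j hj => hψ j (Finset.mem_range.1 hj)
  -- partial sums / products are dominated by the full ones
  have hψ_partial : ∀ j ≤ J, ∑ i ∈ range j, ψ i ≤ Ψ := fun j hj =>
    Finset.sum_le_sum_of_subset_of_nonneg (Finset.range_subset_range.2 hj)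
      fun i hi _ => hψ i (Finset.mem_range.1 hi)
  have hφ_partial : ∀ j ≤ J, ∑ i ∈ range j, φ i ≤ Φ := fun j hj =>
    Finset.sum_le_sum_of_subset_of_nonneg (Finset.range_subset_range.2 hj)
      fun i hi _ => hφ i (Finset.mem_range.1 hi)
  have hχ_prod_le : ∀ j ≤ J, ∏ i ∈ range j, χ i ≤ 1 := fun j hj =>
    Finset.prod_le_one (fun i hi => (hχ i ((Finset.mem_range.1 hi).trans_le hj)).1)
      fun i hi => (hχ i ((Finset.mem_range.1 hi).trans_le hj)).2
  have hχ_prod_nn : ∀ j ≤ J, 0 ≤ ∏ i ∈ range j, χ i := fun j hj =>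
    Finset.prod_nonneg fun i hi => (hχ i ((Finset.mem_range.1 hi).trans_le hj)).1
  -- (b) the fast size along the period
  have hfastS : ∀ j ≤ J, F j ≤ (∑ i ∈ range j, ψ i) * S + (∏ i ∈ range j, χ i) * F 0 := by
    intro j
    induction j with
    | zero => intro _; simp
    | succ j ih =>
      intro hj
      have hjJ : j < J := Nat.lt_of_succ_le hj
      have ih' := ih hjJ.le
      have h1 := hfast j hjJ
      have hχj := hχ j hjJ
      have hψj := hψ j hjJ
      rw [Finset.sum_range_succ, Finset.prod_range_succ]
      have hαj : ‖α j‖ ≤ S := hS_ge j hjJ.le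
      have e1 : ψ j * ‖α j‖ ≤ ψ j * S := mul_le_mul_of_nonneg_left hαj hψj
      have e2 : χ j * F j ≤ χ j * ((∑ i ∈ range j, ψ i) * S + (∏ i ∈ range j, χ i) * F 0) :=
        mul_le_mul_of_nonneg_left ih' hχj.1
      have e3 : χ j * ((∑ i ∈ range j, ψ i) * S) ≤ (∑ i ∈ range j, ψ i) * S := by
        have hnn : 0 ≤ (∑ i ∈ range j, ψ i) * S :=
          mul_nonneg (Finset.sum_nonneg fun i hi => hψ i ((Finset.mem_range.1 hi).trans hjJ)) hS0
        nlinarith [hχj.1, hχj.2]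
      nlinarith [e1, e2, e3, hχ_prod_nn j hjJ.le]
  have hfastS' : ∀ j ≤ J, F j ≤ Ψ * S + F 0 := by
    intro j hj
    refine (hfastS j hj).trans (add_le_add (mul_le_mul_of_nonneg_right (hψ_partial j hj) hS0) ?_)
    have := mul_le_mul_of_nonneg_right (hχ_prod_le j hj) hF00
    linarith
  -- (d) the slow norms along the period
  have hslowS : ∀ j ≤ J, ‖α j‖ ≤ ‖α 0‖ + (∑ i ∈ range j, φ i) * (Ψ * S + F 0) := by
    intro j
    induction j with
    | zero => intro _; simp
    | succ j ih =>
      intro hj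
      have hjJ : j < J := Nat.lt_of_succ_le hj
      have ih' := ih hjJ.le
      rw [Finset.sum_range_succ]
      have h1 : ‖α (j + 1)‖ ≤ ‖D j (α j)‖ + φ j * F j := by
        have := norm_le_insert' (α (j + 1)) (D j (α j))
        have h2 := hslow j hjJ
        linarith [norm_sub_rev (α (j + 1)) (D j (α j))]
      have h3 : ‖D j (α j)‖ ≤ ‖α j‖ :=
        (ContinuousLinearMap.le_opNorm _ _).trans
          ((mul_le_mul_of_nonneg_right (hD j hjJ) (norm_nonneg _)).trans_eq (one_mul _))
      have h4 : φ j * F j ≤ φ j * (Ψ * S + F 0) :=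
        mul_le_mul_of_nonneg_left (hfastS' j hjJ.le) (hφ j hjJ)
      nlinarith [h1, h3, h4, ih']
  -- (e) the maximum is at most twice the datum
  have hS_le : S ≤ ‖α 0‖ + Φ * (Ψ * S + F 0) := by
    refine Finset.sup'_le _ _ fun j hj => ?_
    have hjJ : j ≤ J := Nat.le_of_lt_succ (Finset.mem_range.1 hj)
    refine (hslowS j hjJ).trans (add_le_add le_rfl ?_)
    exact mul_le_mul_of_nonneg_right (hφ_partial j hjJ) (by positivity)
  have hS2 : S ≤ 2 * (‖α 0‖ + Φ * F 0) := by
    have hΦΨS : Φ * Ψ * S ≤ (1 / 2) * S := mul_le_mul_of_nonneg_right hΦΨ hS0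
    nlinarith [hS_le, hΦΨS]
  -- (f) the fast bound at the end of the period
  have hFJ : F J ≤ Ψ * S + (∏ j ∈ range J, χ j) * F 0 := by
    have := hfastS J le_rfl
    simpa only [← hΨdef] using this
  refine ⟨?_, ?_⟩
  swap
  · have e : Ψ * S ≤ Ψ * (2 * (‖α 0‖ + Φ * F 0)) := mul_le_mul_of_nonneg_left hS2 hΨ0
    nlinarith [hFJ, e]
  -- (g) the slow LOWER bound: deviation from the unperturbed product
  · -- unperturbed products Q j = D (j-1) ∘ ⋯ ∘ D 0
    set Q : ℕ → (E →L[ℝ] E) := fun j => (List.ofFn fun i : Fin j => D (j - 1 - (i : ℕ))).prod with hQdef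
    have hQ_succ : ∀ j, Q (j + 1) = D j * Q j := fun j => by
      simp only [hQdef]
      exact prod_ofFn_rev_succ D j
    have hdev : ∀ j ≤ J, ‖α j - Q j (α 0)‖ ≤ (∑ i ∈ range j, φ i) * (Ψ * S + F 0) := by
      intro j
      induction j with
      | zero =>
        intro _
        simp [hQdef]
      | succ j ih =>
        intro hj
        have hjJ : j < J := Nat.lt_of_succ_le hj
        have ih' := ih hjJ.le
        rw [Finset.sum_range_succ, hQ_succ j, mul_apply_eq_comp]
        have hsplit : α (j + 1) - D j (Q j (α 0)) =
            (α (j + 1) - D j (α j)) + D j (α j - Q j (α 0)) := by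
          rw [map_sub]; abel
        rw [hsplit]
        refine (norm_add_le _ _).trans ?_
        have h1 := hslow j hjJ
        have h2 : ‖D j (α j - Q j (α 0))‖ ≤ ‖α j - Q j (α 0)‖ :=
          (ContinuousLinearMap.le_opNorm _ _).trans
            ((mul_le_mul_of_nonneg_right (hD j hjJ) (norm_nonneg _)).trans_eq (one_mul _))
        have h4 : φ j * F j ≤ φ j * (Ψ * S + F 0) :=
          mul_le_mul_of_nonneg_left (hfastS' j hjJ.le) (hφ j hjJ)
        nlinarith [h1, h2, h4, ih']
    have hdevJ : ‖α J - Q J (α 0)‖ ≤ Φ * (Ψ * S + F 0) := by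
      have := hdev J le_rfl
      simpa only [← hΦdef] using this
    have hQJ : m * ‖α 0‖ ≤ ‖Q J (α 0)‖ := hm (α 0)
    have htri : ‖Q J (α 0)‖ ≤ ‖α J‖ + ‖α J - Q J (α 0)‖ := by
      have := norm_sub_le (α J) (α J - Q J (α 0))
      simp only [sub_sub_cancel] at this
      exact this
    have hΦΨS : Φ * Ψ * S ≤ Φ * Ψ * (2 * (‖α 0‖ + Φ * F 0)) :=
      mul_le_mul_of_nonneg_left hS2 (mul_nonneg hΦ0 hΨ0)
    have hΦF : Φ * Ψ * (2 * (Φ * F 0)) ≤ Φ * F 0 := by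
      have : 2 * (Φ * Ψ) ≤ 1 := by linarith
      have hΦF0 : 0 ≤ Φ * F 0 := mul_nonneg hΦ0 hF00
      nlinarith [this, hΦF0]
    nlinarith [hdevJ, hQJ, htri, hΦΨS, hΦF]

end PeriodBlock

end BlockRecursion

end Literature.Analysis.ODE
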